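import Literature.Probability.LatticeModels.TorusTwoPointLimit
import Literature.Probability.LatticeModels.SharpnessSubcritical
import Literature.Probability.LatticeModels.TorusFoldable
import HarnessLib

/-!
# Duminil-Copin–Panis 2025, Theorem 1.2 on the even torus: the torus inequality from Lemma 2.5

Topic `Literature/Probability/LatticeModels`; family `crit-ising`. Third layer (after
`ReflectedCurrents.lean` — fold data `IsFoldable`, the switching lemma for reflected currents
(Lemma 2.3), the handshake — and `TorusFoldable.lean` — the reflections of an even torus are fold
data) of the tree's route to the named fact
`Literature.Probability.LatticeModels.dcp_reflectedGradient_lower` (Duminil-Copin–Panis, CMP 406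
(2025), arXiv:2404.05700, **Theorem 1.2** at `β_c`; `CriticalTwoPointDCPLower.lean`). The source's
§2.2 ("Proof of the theorem") argues inside ONE configuration of the (infinite-volume) sourceless
random current `𝐏^∅_β` with all `2d` reflections `𝓡_n(±e_i)` at once (the random set
`𝒮_n = ⋂_i 𝒮_n(+e_i) ∩ 𝒮_n(-e_i)`, (2.20)–(2.24)); the tree runs the same argument on the even tori
`(ℤ/Lℤ)^d` (all reflections are symmetries), which this file sets up:

* **torus transport** (`namespace Torus`): `isingTwoPoint_free_eq_torus` (the free two-point function
  in a sub-volume `S ⊆ Λ_M ⊂ ℤ^d` equals the one in `S̄ ⊂ (ℤ/Lℤ)^d`, `2M+1 < L`),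
  `image_neighbor_filter_eq`, `sum_boundary_transport` (the boundary functional `φ_β(S)` read in the torus);
* **direction data** (`namespace DCPLower`): `sgn`, `dirRefl δ n` (`𝓡_n(±e_i)` on `ℤ^d`),
  `dirTheta L n δ` / `dirHalf L n δ` (the torus reflection through the sites `x_i = ±n` and its
  strict half containing the box), `isFoldable_dir`, `dirTheta_proj` (`θ_δ x̄ = \overline{𝓡_δ x}`),
  `proj_zero_mem_dirHalf`, `dirTheta_proj_eq_self` (face points are fixed);
* **the pointwise inequality** `DCPLower.pointwise_master` — (2.20)–(2.24) for one current
  configuration, abstracted to predicates `c_δ` on `Λ_n` ("`z̄ ↔_{ℳ_δ} ℍ_δ`") under the sharpness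
  input `φ_β(S) ≥ 1` for `S ∋ 0` inside `Λ_n`: `1 ≤ ∑_δ 𝟙[c_δ 0] + tanh β ∑_δ ∑_{x,y ∈ Λ_n, y∼x}
  𝟙[¬c_δ 0, ¬c_δ x, c_δ y] ⟨σ_{0̄}σ_{x̄}⟩^∅_{W_δ}`, `W_δ = {z ∈ Λ_n : ¬c_δ z}` (Griffiths' monotonicity
  `S ⊆ W_δ` bounds each boundary term of `φ_β(S)`);
* **Lemma 2.4** (current form): `IsFoldable.tsum_empty_connFix_le` — `Z^∅[o ↔_ℳ ℍ] ≤ Z^{{o,θo}}` (from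
  Lemma 2.3); and `IsFoldable.currentZ_pair_theta_le` — `Z^{{o,θx}} ≤ Z^{{o,x}}` for `o, x ∈ H₋` (the
  step `Z^{{0,x}}[x ↔ ℍ] = Z^{{0,𝓡x}}` of the proof of Lemma 2.5, with the handshake for `θ^*n`,
  `IsFoldable.fold_creflect`);
* **`DCPLower.torusIneq_of_lemma25`** — integrating the pointwise inequality against `𝐏^∅_{𝕋_L}` and
  using Lemma 2.4 and the per-pair **Lemma 2.5** (taken as the hypothesis `H25`, in current form:
  `∑_{∂𝐧=∅} w(𝐧) 𝟙[0̄,x̄ ∈ W_δ(𝐧), ȳ ↔ ℍ_δ] ⟨σ_{0̄}σ_{x̄}⟩_{W_δ(𝐧)} ≤ (Z^{{0̄,x̄}} - Z^{{0̄,θ_δx̄}}) ⟨σ_ȳσ_{θ_δȳ}⟩_{𝕋_L}`)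
  gives, after division by `Z^∅` (`isingTwoPoint_univ_eq_currentZ_div`), the **torus inequality**
  `1 ≤ ∑_δ ( ⟨σ_{0̄}σ_{θ_δ0̄}⟩_{𝕋_L} + tanh β ∑_{x,y ∈ Λ_n, y∼x} (⟨σ_{0̄}σ_{x̄}⟩ - ⟨σ_{0̄}σ_{θ_δx̄}⟩) ⟨σ_ȳσ_{θ_δȳ}⟩ )`.

The prefactor is `tanh β` because the tree's sharpness input is Duminil-Copin–Tassion's
`φ_β(S) = ∑ tanh(β) ⟨σ₀σ_x⟩_S ≥ 1` at `β ≥ β_c` (`one_le_dctIsingPhi_of_criticalBeta_le`); the constant of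
Theorem 1.2 absorbs it. No named fact; definitions with bodies (`sgn`, `dirRefl`, `dirTheta`, `dirHalf`) only.

## References

* H. Duminil-Copin, R. Panis, *New lower bounds for the (near) critical Ising and φ⁴ models’ two-point
  functions*, Comm. Math. Phys. 406 (2025), arXiv:2404.05700, §2.2: Lemma 2.4, Lemma 2.5 and
  eqs. (2.20)–(2.24) [DuminilCopinPanis2025LowerBounds] (held: `lit read arxiv:2404.05700`, chunks 9–11).
* H. Duminil-Copin, V. Tassion, CMP 343 (2016), arXiv:1502.03050, §2.1 (`φ_β(S)`)
  [DuminilCopinTassionCMP2016] — through `SharpnessSubcritical.lean` / `SusceptibilityMeanFieldBound.lean`.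
* S. Friedli, Y. Velenik, CUP 2017, §3.1, Exercise 3.12 [FriedliVelenik2017]; H. Duminil-Copin,
  arXiv:1607.06933, §2.2.1 [DuminilCopinECM2018] — transport, Griffiths, random-current dictionary.
-/

noncomputable section

open Finset

namespace Literature.Probability.LatticeModels

namespace Torus

variable {d : ℕ}

/-- **Transport of restricted free two-point functions from `ℤ^d` to a large torus**: for a volume
`S ⊆ Λ_M` and `2M + 1 < L`, the free-boundary zero-field two-point function in `S` equals the one in
the image of `S` in `(ℤ/Lℤ)^d` (the projection is injective on `Λ_M` and a graph isomorphism there;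
Friedli–Velenik 2017, §3.1: the free Hamiltonian only involves the edges inside the volume). [cite: FriedliVelenik2017, §3.1] -/
theorem isingTwoPoint_free_eq_torus {L : ℕ} [NeZero L] {M : ℕ} (hML : 2 * M + 1 < L)
    {S : Finset (Site d)} (hS : S ⊆ box d M) (β : ℝ) {x y : Site d} (hx : x ∈ S) (hy : y ∈ S) :
    isingTwoPoint (zdGraph d) S β 0 .free x y =
      isingTwoPoint (torusGraph d L) (S.image (Torus.proj L)) β 0 .free (Torus.proj L x) (Torus.proj L y) := by
  classical
  set T := ↥(box d M) with hT
  let ι₁ : T ↪ Site d := Function.Embedding.subtype _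
  let Gs : SimpleGraph T := (zdGraph d).comap ι₁
  let Λs : Finset T := (Finset.univ : Finset T).filter fun a => (a : Site d) ∈ S
  have hmap₁ : Λs.map ι₁ = S := by
    ext z
    simp only [Finset.mem_map, Finset.mem_filter, Finset.mem_univ, true_and, Λs]
    constructor
    · rintro ⟨a, ha, rfl⟩; exact ha
    · intro hz; exact ⟨⟨z, hS hz⟩, hz, rfl⟩
  have h1 : isingTwoPoint (zdGraph d) S β 0 .free x y =
      isingTwoPoint Gs Λs β 0 .free ⟨x, hS hx⟩ ⟨y, hS hy⟩ := by
    have := isingTwoPoint_free_map (G := Gs) (G' := zdGraph d) ι₁ (Λ := Λs)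
      (fun a _ b _ => Iff.rfl) β 0 ⟨x, hS hx⟩ ⟨y, hS hy⟩
    rw [hmap₁] at this
    exact this
  let ι₂ : T ↪ TorusSite d L :=
    ⟨fun a => Torus.proj L a.1, fun a b hab =>
      Subtype.ext (torusProj_injOn_box (by omega) a.2 b.2 hab)⟩
  have hadj : ∀ a ∈ Λs, ∀ b ∈ Λs, ((torusGraph d L).Adj (ι₂ a) (ι₂ b) ↔ Gs.Adj a b) := fun a _ b _ =>
    torusGraph_adj_proj_iff hML a.2 b.2
  have hmap₂ : Λs.map ι₂ = S.image (Torus.proj L) := by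
    ext z
    simp only [Finset.mem_map, Finset.mem_filter, Finset.mem_univ, true_and, Finset.mem_image, Λs]
    constructor
    · rintro ⟨a, ha, rfl⟩; exact ⟨a.1, ha, rfl⟩
    · rintro ⟨w, hw, rfl⟩; exact ⟨⟨w, hS hw⟩, hw, rfl⟩
  have h2 := isingTwoPoint_free_map (G := Gs) (G' := torusGraph d L) ι₂ hadj β 0 ⟨x, hS hx⟩ ⟨y, hS hy⟩
  rw [hmap₂] at h2
  rw [h1, ← h2]
  rfl

/-- **Neighbours outside a set, seen in the torus**: for `x ∈ Λ_m`, `S ⊆ Λ_{m+1}` and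
`2(m+1) + 1 < L`, the projection maps the `ℤ^d`-neighbours of `x` outside `S` bijectively onto the
torus-neighbours of `x̄` outside `S̄` (no wrap-around is seen). [folklore] -/
theorem image_neighbor_filter_eq {L : ℕ} [NeZero L] {m : ℕ} (hmL : 2 * (m + 1) + 1 < L)
    {S : Finset (Site d)} (hS : S ⊆ box d (m + 1)) {x : Site d} (hx : x ∈ box d m) :
    (((zdGraph d).neighborFinset x).filter fun y => y ∉ S).image (Torus.proj L) =
      (Finset.univ \ S.image (Torus.proj L)).filter ((torusGraph d L).Adj (Torus.proj L x)) := by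
  classical
  have hxm1 : x ∈ box d (m + 1) := box_mono d (Nat.le_succ m) hx
  have hnb : ∀ {y : Site d}, (zdGraph d).Adj x y → y ∈ box d (m + 1) := fun hxy => by
    rw [mem_box_iff_supNorm_le] at hx ⊢
    have := Site.supNorm_le_succ_of_adj hxy
    omega
  ext y'
  simp only [mem_image, mem_filter, SimpleGraph.mem_neighborFinset, mem_sdiff, mem_univ, true_and]
  constructor
  · rintro ⟨y, ⟨hxy, hyS⟩, rfl⟩
    refine ⟨?_, (torusGraph_adj_proj_iff hmL hxm1 (hnb hxy)).2 hxy⟩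
    rintro ⟨s, hs, hsy⟩
    have := torusProj_injOn_box (by omega) (hS hs) (hnb hxy) hsy
    subst this
    exact hyS hs
  · rintro ⟨hy'S, hadj⟩
    obtain ⟨-, y, rfl, hxy⟩ := (torusGraph_adj_proj_left_iff L x y').1 hadj
    exact ⟨y, ⟨hxy, fun hyS => hy'S ⟨y, hyS, rfl⟩⟩, rfl⟩

/-- The projection is injective on the neighbours of a point of `Λ_m` (`2(m+1) + 1 < L`). [folklore] -/
theorem proj_injOn_neighbor {L : ℕ} {m : ℕ} (hmL : 2 * (m + 1) + 1 < L) {x : Site d} (hx : x ∈ box d m) :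
    Set.InjOn (Torus.proj L) (((zdGraph d).neighborFinset x) : Set (Site d)) := by
  intro y hy z hz hyz
  rw [Finset.mem_coe, SimpleGraph.mem_neighborFinset] at hy hz
  have hnb : ∀ {y : Site d}, (zdGraph d).Adj x y → y ∈ box d (m + 1) := fun hxy => by
    rw [mem_box_iff_supNorm_le] at hx ⊢
    have := Site.supNorm_le_succ_of_adj hxy
    omega
  exact torusProj_injOn_box (by omega) (hnb hy) (hnb hz) hyz

/-- **The boundary functional transported to the torus**: for `S ⊆ Λ_m` (so that the neighbours of
its points lie in `Λ_{m+1}`) and `2(m+1)+1 < L`, and any weight `g`,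
`∑_{x' ∈ S̄} ∑_{y' ∉ S̄, y' ∼ x'} g(x') ⟨σ_{0̄}σ_{x'}⟩^𝕋_{S̄} = ∑_{x ∈ S} ∑_{y ∉ S, y ∼ x} g(x̄) ⟨σ₀σ_x⟩^{ℤ^d}_S`. [cite: FriedliVelenik2017, §3.1] -/
theorem sum_boundary_transport {L : ℕ} [NeZero L] {m : ℕ} (hmL : 2 * (m + 1) + 1 < L)
    {S : Finset (Site d)} (hS : S ⊆ box d m) (h0 : (0 : Site d) ∈ S) (β : ℝ) (g : TorusSite d L → ℝ) :
    ∑ x' ∈ S.image (Torus.proj L), ∑ _y' ∈ (Finset.univ \ S.image (Torus.proj L)).filter ((torusGraph d L).Adj x'),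
        g x' * isingTwoPoint (torusGraph d L) (S.image (Torus.proj L)) β 0 .free (Torus.proj L 0) x' =
      ∑ x ∈ S, ∑ _y ∈ ((zdGraph d).neighborFinset x).filter (fun y => y ∉ S),
        g (Torus.proj L x) * isingTwoPoint (zdGraph d) S β 0 .free 0 x := by
  classical
  have hinjS : Set.InjOn (Torus.proj L) (S : Set (Site d)) := fun a ha b hb hab =>
    torusProj_injOn_box (by omega) (hS ha) (hS hb) hab
  rw [Finset.sum_image hinjS]
  refine Finset.sum_congr rfl fun x hx => ?_
  have hS' : S ⊆ box d (m + 1) := hS.trans (box_mono d (Nat.le_succ m))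
  rw [← image_neighbor_filter_eq hmL hS' (hS hx), Finset.sum_image]
  · refine Finset.sum_congr rfl fun y _ => ?_
    rw [Torus.isingTwoPoint_free_eq_torus (L := L) (M := m) (by omega) hS β h0 hx]
  · intro a ha b hb hab
    exact proj_injOn_neighbor hmL (hS hx) (mem_filter.1 ha).1 (mem_filter.1 hb).1 hab

end Torus

namespace DCPLower

variable {d : ℕ}

/-! ### Generic positivity -/

/-- `0 ≤ ⟨σ_xσ_y⟩^∅_{Λ;β,0}` on any locally finite graph, for `β ≥ 0` and `x, y ∈ Λ` (GKS I). [cite: FriedliVelenik2017, Theorem 3.20] -/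
theorem isingTwoPoint_free_nonneg_of_mem {V : Type*} [DecidableEq V] (G : SimpleGraph V) [G.LocallyFinite]
    {β : ℝ} (hβ : 0 ≤ β) {Λ : Finset V} {x y : V} (hx : x ∈ Λ) (hy : y ∈ Λ) :
    0 ≤ isingTwoPoint G Λ β 0 .free x y := by
  by_cases hxy : x = y
  · subst hxy; simp
  rw [isingTwoPoint_eq_isingCorr _ _ _ _ _ hxy]
  refine GKSInequalities.gks_one_holds G hβ le_rfl (Or.inl rfl) ?_
  intro w hw
  simp only [mem_insert, mem_singleton] at hw
  rcases hw with rfl | rfl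
  · exact hx
  · exact hy

/-- **Griffiths' volume monotonicity for two-point functions** on any locally finite graph (free
boundary condition, `β ≥ 0`). [cite: FriedliVelenik2017, Exercise 3.12, p. 112] -/
theorem isingTwoPoint_free_le_of_subset {V : Type*} [DecidableEq V] (G : SimpleGraph V) [G.LocallyFinite]
    {β : ℝ} (hβ : 0 ≤ β) {Λ₁ Λ₂ : Finset V} (h12 : Λ₁ ⊆ Λ₂) {x y : V} (hx : x ∈ Λ₁) (hy : y ∈ Λ₁) :
    isingTwoPoint G Λ₁ β 0 .free x y ≤ isingTwoPoint G Λ₂ β 0 .free x y := by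
  by_cases hxy : x = y
  · subst hxy; simp
  rw [isingTwoPoint_eq_isingCorr _ _ _ _ _ hxy, isingTwoPoint_eq_isingCorr _ _ _ _ _ hxy]
  refine isingCorr_free_le_of_subset G hβ le_rfl ?_ h12
  intro w hw
  simp only [mem_insert, mem_singleton] at hw
  rcases hw with rfl | rfl
  · exact hx
  · exact hy

/-! ### Lattice geometry of the box -/

/-- A box point that avoids all faces lies in the smaller box. [folklore] -/
theorem mem_box_pred_of_forall_ne {n : ℕ} {x : Site d} (hx : x ∈ box d n)
    (h : ∀ i : Fin d, x i ≠ n ∧ x i ≠ -n) : x ∈ box d (n - 1) := by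
  rw [mem_box] at hx ⊢
  intro i
  have := hx i
  have h1 := (h i).1
  have h2 := (h i).2
  omega

/-- Neighbours of points of `Λ_{n-1}` lie in `Λ_n` (`n ≥ 1`). [folklore] -/
theorem mem_box_of_adj_of_mem_box_pred {n : ℕ} (hn : 1 ≤ n) {x y : Site d} (hx : x ∈ box d (n - 1))
    (hxy : (zdGraph d).Adj x y) : y ∈ box d n := by
  rw [mem_box_iff_supNorm_le] at hx ⊢
  have := Site.supNorm_le_succ_of_adj hxy
  omega


/-! ### Direction data on the even torus -/

section TorusDirections

open scoped ENNReal symmDiff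

variable {L : ℕ} [NeZero L]

/-- The sign of a direction `δ = (i, b)`: `+1` for `b = true` (hyperplane `x_i = n`), `-1` for
`b = false` (hyperplane `x_i = -n`). [folklore] -/
def sgn (b : Bool) : ℤ := if b then 1 else -1

/-- The sign of `+`. [folklore] -/
@[simp] theorem sgn_true : sgn true = 1 := rfl

/-- The sign of `-`. [folklore] -/
@[simp] theorem sgn_false : sgn false = -1 := rfl

/-- Signs square to one. [folklore] -/
theorem sgn_mul_sgn (b : Bool) : sgn b * sgn b = 1 := by cases b <;> simp [sgn]

/-- The lattice reflection `𝓡_n(εe_i)` of Duminil-Copin–Panis 2025, §2.2, in the hyperplane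
`ℍ_n(εe_i) = {x : x_i = εn}`: `x_i ↦ 2εn - x_i`. [cite: DuminilCopinPanis2025LowerBounds, §2.2 (the reflections 𝓡_n(±e_i))] -/
def dirRefl (δ : Fin d × Bool) (n : ℤ) (x : Site d) : Site d :=
  Function.update x δ.1 (2 * (sgn δ.2 * n) - x δ.1)

/-- Coordinates of the direction reflection. [folklore] -/
theorem dirRefl_apply (δ : Fin d × Bool) (n : ℤ) (x : Site d) (j : Fin d) :
    dirRefl δ n x j = if j = δ.1 then 2 * (sgn δ.2 * n) - x δ.1 else x j := by
  unfold dirRefl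
  rw [Function.update_apply]

/-- The torus reflection of the direction `δ = (i, ±)` at level `n`: through the sites `x_i = ±n`. [cite: DuminilCopinPanis2025LowerBounds, §2.2] -/
def dirTheta (L : ℕ) (n : ℕ) (δ : Fin d × Bool) : TorusSite d L ≃ TorusSite d L :=
  Torus.reflectThroughSites δ.1 (((sgn δ.2 * n : ℤ)) : ZMod L)

/-- The strict half of the torus attached to the direction `δ` (the side containing the box):
`leftSites i n` for `+e_i`, `rightSites i (-n)` for `-e_i`. [cite: DuminilCopinPanis2025LowerBounds, §2.2] -/
def dirHalf (L : ℕ) [NeZero L] (n : ℕ) (δ : Fin d × Bool) : Finset (TorusSite d L) :=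
  if δ.2 then Torus.leftSites δ.1 (((sgn δ.2 * n : ℤ)) : ZMod L)
  else Torus.rightSites δ.1 (((sgn δ.2 * n : ℤ)) : ZMod L)

/-- **Every direction gives a fold datum on the even torus.** [cite: DuminilCopinPanis2025LowerBounds, §2.2] -/
theorem isFoldable_dir (hL : Even L) (h2 : 2 < L) (n : ℕ) (δ : Fin d × Bool) :
    IsFoldable (torusGraph d L) (dirTheta L n δ) univ (dirHalf L n δ) := by
  unfold dirTheta dirHalf
  obtain ⟨i, b⟩ := δ
  cases b
  · simpa using Torus.isFoldable_rightSites (d := d) hL h2 i (((sgn false * n : ℤ)) : ZMod L)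
  · simpa using Torus.isFoldable_leftSites (d := d) hL h2 i (((sgn true * n : ℤ)) : ZMod L)

omit [NeZero L] in
/-- The torus reflection of a direction is the projection of the lattice one. [folklore] -/
theorem dirTheta_proj (n : ℕ) (δ : Fin d × Bool) (z : Site d) :
    dirTheta L n δ (Torus.proj L z) = Torus.proj L (dirRefl δ n z) := by
  unfold dirTheta dirRefl
  exact Torus.reflectThroughSites_intCast_proj δ.1 _ z

/-- The origin lies in the half of every direction (`n ≥ 1`, `4n + 2 ≤ L`). [folklore] -/
theorem proj_zero_mem_dirHalf (hL : Even L) {n : ℕ} (hn : 1 ≤ n) (hnL : 4 * n + 2 ≤ L) (δ : Fin d × Bool) :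
    Torus.proj L (0 : Site d) ∈ dirHalf L n δ := by
  unfold dirHalf
  obtain ⟨i, b⟩ := δ
  cases b
  · simp only [Bool.false_eq_true, if_false, sgn]
    rw [show ((-1 : ℤ) * n : ℤ) = ((-(n : ℤ) : ℤ)) by ring]
    rw [Torus.proj_mem_rightSites_iff hL i (m := n) (n := -(n : ℤ)) (by rw [abs_neg]; exact le_of_eq (abs_of_nonneg (by positivity))) hnL
      (zero_mem_box d n)]
    simp; omega
  · simp only [if_true, sgn, one_mul]
    rw [Torus.proj_mem_leftSites_iff hL i (m := n) (n := (n : ℤ)) (le_of_eq (abs_of_nonneg (by positivity))) hnL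
      (zero_mem_box d n)]
    simp; omega

/-- Face points of the box are fixed by the corresponding direction reflection. [folklore] -/
theorem dirTheta_proj_eq_self (hL : Even L) {n : ℕ} (hnL : 4 * n + 2 ≤ L) {z : Site d} (hz : z ∈ box d n)
    (δ : Fin d × Bool) (hface : z δ.1 = sgn δ.2 * n) :
    dirTheta L n δ (Torus.proj L z) = Torus.proj L z := by
  unfold dirTheta
  have habs : |(sgn δ.2 * n : ℤ)| ≤ n := by
    unfold sgn; split_ifs <;> simp
  exact (Torus.reflect_proj_eq_self_iff hL δ.1 habs hnL hz).2 hface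

/-- **Box points lie in the half of a direction or on its hyperplane** (`4n + 2 ≤ L`): `x̄ ∈ H_δ` or
`θ_δ x̄ = x̄`. [folklore] -/
theorem proj_mem_dirHalf_or_fixed (hL : Even L) {n : ℕ} (hnL : 4 * n + 2 ≤ L) {x : Site d} (hx : x ∈ box d n)
    (δ : Fin d × Bool) : Torus.proj L x ∈ dirHalf L n δ ∨ dirTheta L n δ (Torus.proj L x) = Torus.proj L x := by
  obtain ⟨i, b⟩ := δ
  have hxi := (mem_box.1 hx) i
  by_cases hface : x i = sgn b * n
  · exact Or.inr (dirTheta_proj_eq_self hL hnL hx (i, b) hface)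
  · left
    unfold dirHalf
    cases b
    · simp only [Bool.false_eq_true, if_false, sgn]
      rw [show ((-1 : ℤ) * n : ℤ) = ((-(n : ℤ) : ℤ)) by ring]
      rw [Torus.proj_mem_rightSites_iff hL i (m := n) (n := -(n : ℤ))
        (by rw [abs_neg]; exact le_of_eq (abs_of_nonneg (by positivity))) hnL hx]
      simp [sgn] at hface
      omega
    · simp only [if_true, sgn, one_mul]
      rw [Torus.proj_mem_leftSites_iff hL i (m := n) (n := (n : ℤ)) (le_of_eq (abs_of_nonneg (by positivity))) hnL hx]
      simp [sgn] at hface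
      omega

end TorusDirections

/-! ### The pointwise inequality behind Theorem 1.2 on the torus -/

/-- **The pointwise inequality** (Duminil-Copin–Panis 2025, §2.2, from (2.20) to (2.24), for ONE
current configuration, abstracted): let `c_δ` (`δ = (i, ±)`, the `2d` directions) be predicates on
the box `Λ_n ⊂ ℤ^d` such that every face point `z_i = ±n` satisfies the corresponding `c_{(i,±)}`
("points of `ℍ_n(±e_i)` are connected to it"), let `S = {z ∈ Λ_n : ¬c_δ(z) ∀ δ}` and
`W_δ = {z ∈ Λ_n : ¬c_δ(z)}`, read in a torus `(ℤ/Lℤ)^d`, `L > 2n+1`. If the sharpness input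
`φ_β(S') ≥ 1` holds for every `S' ∋ 0` inside `Λ_n` (at `β = β_c`: Duminil-Copin–Tassion's
`β̃_c = β_c`, `n ≤ L(β_c) = ∞`), then
`1 ≤ ∑_δ 𝟙[c_δ 0] + tanh β ∑_δ ∑_{x,y ∈ Λ_n, y ∼ x} 𝟙[¬c_δ 0, ¬c_δ x, c_δ y] ⟨σ_{0̄}σ_{x̄}⟩^∅_{W_δ}`:
either `0 ∉ S`, or `φ_β(S) ≥ 1` and each boundary term `tanh β ⟨σ₀σ_x⟩_S` (`x ∈ S`, `y ∼ x`,
`y ∉ S`, so `c_δ(y)` for some `δ`) is at most `tanh β ⟨σ_{0̄}σ_{x̄}⟩_{W_δ}` by Griffiths'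
monotonicity (`S ⊆ W_δ`). [cite: DuminilCopinPanis2025LowerBounds, §2.2, eqs. (2.20)–(2.24)] -/
theorem pointwise_master {L : ℕ} [NeZero L] {n : ℕ} (hn : 1 ≤ n) (hnL : 2 * n + 1 < L) {β : ℝ} (hβ : 0 ≤ β)
    (hφ : ∀ S : Finset (Site d), (0 : Site d) ∈ S → S ⊆ box d n → 1 ≤ dctIsingPhi d β S)
    (c : Fin d × Bool → Site d → Prop) [∀ δ z, Decidable (c δ z)]
    (hface : ∀ z ∈ box d n, ∀ i : Fin d, (z i = n → c (i, true) z) ∧ (z i = -(n : ℤ) → c (i, false) z)) :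
    (1 : ℝ) ≤ (∑ δ : Fin d × Bool, if c δ 0 then (1 : ℝ) else 0) +
      Real.tanh β * ∑ δ : Fin d × Bool, ∑ x ∈ box d n, ∑ y ∈ box d n,
        if (zdGraph d).Adj x y ∧ ¬ c δ 0 ∧ ¬ c δ x ∧ c δ y then
          isingTwoPoint (torusGraph d L) (((box d n).filter fun z => ¬ c δ z).image (Torus.proj L)) β 0 .free
            (Torus.proj L 0) (Torus.proj L x)
        else 0 := by
  classical
  set W : Fin d × Bool → Finset (TorusSite d L) :=
    fun δ => ((box d n).filter fun z => ¬ c δ z).image (Torus.proj L) with hW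
  have h0box : (0 : Site d) ∈ box d n := zero_mem_box d n
  have hmemW : ∀ {δ : Fin d × Bool} {z : Site d}, z ∈ box d n → ¬ c δ z → Torus.proj L z ∈ W δ :=
    fun hz hc => mem_image.2 ⟨_, mem_filter.2 ⟨hz, hc⟩, rfl⟩
  -- every summand of the triple sum is nonnegative
  have hterm : ∀ δ, ∀ x ∈ box d n, ∀ y, 0 ≤ (if (zdGraph d).Adj x y ∧ ¬ c δ 0 ∧ ¬ c δ x ∧ c δ y then
      isingTwoPoint (torusGraph d L) (W δ) β 0 .free (Torus.proj L 0) (Torus.proj L x) else 0) := by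
    intro δ x hx y
    split_ifs with h
    · exact isingTwoPoint_free_nonneg_of_mem _ hβ (hmemW h0box h.2.1) (hmemW hx h.2.2.1)
    · exact le_rfl
  have htriple : 0 ≤ ∑ δ : Fin d × Bool, ∑ x ∈ box d n, ∑ y ∈ box d n,
      (if (zdGraph d).Adj x y ∧ ¬ c δ 0 ∧ ¬ c δ x ∧ c δ y then
        isingTwoPoint (torusGraph d L) (W δ) β 0 .free (Torus.proj L 0) (Torus.proj L x) else 0) :=
    sum_nonneg fun δ _ => sum_nonneg fun x hx => sum_nonneg fun y _ => hterm δ x hx y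
  have hind : 0 ≤ ∑ δ : Fin d × Bool, (if c δ 0 then (1 : ℝ) else 0) :=
    sum_nonneg fun δ _ => by split_ifs <;> norm_num
  have htanh : 0 ≤ Real.tanh β := tanh_nonneg hβ
  by_cases h0 : ∃ δ, c δ 0
  · -- `0` is connected in some direction
    obtain ⟨δ₀, hδ₀⟩ := h0
    have h1 : (1 : ℝ) ≤ ∑ δ : Fin d × Bool, (if c δ 0 then (1 : ℝ) else 0) := by
      have := Finset.single_le_sum (f := fun δ : Fin d × Bool => if c δ 0 then (1 : ℝ) else 0)
        (fun δ _ => by split_ifs <;> norm_num) (mem_univ δ₀)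
      simp only [if_pos hδ₀] at this
      exact this
    nlinarith
  · push Not at h0
    -- the random set `S`
    set S : Finset (Site d) := (box d n).filter fun z => ∀ δ, ¬ c δ z with hS
    have h0S : (0 : Site d) ∈ S := mem_filter.2 ⟨h0box, h0⟩
    have hSbox : S ⊆ box d n := filter_subset _ _
    have hSpred : ∀ z ∈ S, z ∈ box d (n - 1) := by
      intro z hz
      obtain ⟨hzbox, hzc⟩ := mem_filter.1 hz
      refine mem_box_pred_of_forall_ne hzbox fun i => ⟨fun h => hzc (i, true) ((hface z hzbox i).1 h),
        fun h => hzc (i, false) ((hface z hzbox i).2 h)⟩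
    have hSW : ∀ δ, S.image (Torus.proj L) ⊆ W δ := by
      intro δ w hw
      obtain ⟨z, hz, rfl⟩ := mem_image.1 hw
      obtain ⟨hzbox, hzc⟩ := mem_filter.1 hz
      exact hmemW hzbox (hzc δ)
    have hφS := hφ S h0S hSbox
    -- termwise bound
    have hA : ∀ x ∈ S, ∀ y ∈ ((zdGraph d).neighborFinset x).filter (fun y => y ∉ S),
        Real.tanh β * isingTwoPoint (zdGraph d) S β 0 .free 0 x ≤
          ∑ δ : Fin d × Bool, Real.tanh β *
            (if (zdGraph d).Adj x y ∧ ¬ c δ 0 ∧ ¬ c δ x ∧ c δ y then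
              isingTwoPoint (torusGraph d L) (W δ) β 0 .free (Torus.proj L 0) (Torus.proj L x) else 0) := by
      intro x hx y hy
      obtain ⟨hyadj, hyS⟩ := mem_filter.1 hy
      rw [SimpleGraph.mem_neighborFinset] at hyadj
      have hybox : y ∈ box d n := mem_box_of_adj_of_mem_box_pred hn (hSpred x hx) hyadj
      have hyc : ∃ δ, c δ y := by
        by_contra hne
        push Not at hne
        exact hyS (mem_filter.2 ⟨hybox, hne⟩)
      obtain ⟨δ₁, hδ₁⟩ := hyc
      obtain ⟨hxbox, hxc⟩ := mem_filter.1 hx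
      have hcond : (zdGraph d).Adj x y ∧ ¬ c δ₁ 0 ∧ ¬ c δ₁ x ∧ c δ₁ y := ⟨hyadj, h0 δ₁, hxc δ₁, hδ₁⟩
      -- `⟨σ₀σ_x⟩_S` (in `ℤ^d`) `= ⟨σ_{0̄}σ_{x̄}⟩_{S̄}` (torus) `≤ ⟨σ_{0̄}σ_{x̄}⟩_{W_{δ₁}}`
      have htrans : isingTwoPoint (zdGraph d) S β 0 .free 0 x ≤
          isingTwoPoint (torusGraph d L) (W δ₁) β 0 .free (Torus.proj L 0) (Torus.proj L x) := by
        rw [Torus.isingTwoPoint_free_eq_torus hnL hSbox β h0S hx]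
        exact isingTwoPoint_free_le_of_subset _ hβ (hSW δ₁) (mem_image_of_mem _ h0S) (mem_image_of_mem _ hx)
      calc Real.tanh β * isingTwoPoint (zdGraph d) S β 0 .free 0 x
          ≤ Real.tanh β * (if (zdGraph d).Adj x y ∧ ¬ c δ₁ 0 ∧ ¬ c δ₁ x ∧ c δ₁ y then
              isingTwoPoint (torusGraph d L) (W δ₁) β 0 .free (Torus.proj L 0) (Torus.proj L x) else 0) := by
            rw [if_pos hcond]
            exact mul_le_mul_of_nonneg_left htrans htanh
        _ ≤ ∑ δ : Fin d × Bool, Real.tanh β *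
            (if (zdGraph d).Adj x y ∧ ¬ c δ 0 ∧ ¬ c δ x ∧ c δ y then
              isingTwoPoint (torusGraph d L) (W δ) β 0 .free (Torus.proj L 0) (Torus.proj L x) else 0) :=
            Finset.single_le_sum (f := fun δ : Fin d × Bool => Real.tanh β *
              (if (zdGraph d).Adj x y ∧ ¬ c δ 0 ∧ ¬ c δ x ∧ c δ y then
                isingTwoPoint (torusGraph d L) (W δ) β 0 .free (Torus.proj L 0) (Torus.proj L x) else 0))
              (fun δ _ => mul_nonneg htanh (hterm δ x hxbox y)) (mem_univ δ₁)
    -- sum the termwise bounds and enlarge the index sets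
    have hB : dctIsingPhi d β S ≤ ∑ x ∈ box d n, ∑ y ∈ box d n, ∑ δ : Fin d × Bool, Real.tanh β *
        (if (zdGraph d).Adj x y ∧ ¬ c δ 0 ∧ ¬ c δ x ∧ c δ y then
          isingTwoPoint (torusGraph d L) (W δ) β 0 .free (Torus.proj L 0) (Torus.proj L x) else 0) := by
      unfold dctIsingPhi
      calc ∑ x ∈ S, ∑ y ∈ ((zdGraph d).neighborFinset x).filter (fun y => y ∉ S),
            Real.tanh β * isingTwoPoint (zdGraph d) S β 0 .free 0 x
          ≤ ∑ x ∈ S, ∑ y ∈ ((zdGraph d).neighborFinset x).filter (fun y => y ∉ S),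
              ∑ δ : Fin d × Bool, Real.tanh β *
                (if (zdGraph d).Adj x y ∧ ¬ c δ 0 ∧ ¬ c δ x ∧ c δ y then
                  isingTwoPoint (torusGraph d L) (W δ) β 0 .free (Torus.proj L 0) (Torus.proj L x) else 0) :=
            sum_le_sum fun x hx => sum_le_sum fun y hy => hA x hx y hy
        _ ≤ ∑ x ∈ S, ∑ y ∈ box d n, ∑ δ : Fin d × Bool, Real.tanh β *
                (if (zdGraph d).Adj x y ∧ ¬ c δ 0 ∧ ¬ c δ x ∧ c δ y then
                  isingTwoPoint (torusGraph d L) (W δ) β 0 .free (Torus.proj L 0) (Torus.proj L x) else 0) := by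
            refine sum_le_sum fun x hx => sum_le_sum_of_subset_of_nonneg ?_ ?_
            · intro y hy
              obtain ⟨hyadj, -⟩ := mem_filter.1 hy
              rw [SimpleGraph.mem_neighborFinset] at hyadj
              exact mem_box_of_adj_of_mem_box_pred hn (hSpred x hx) hyadj
            · intro y _ _
              exact sum_nonneg fun δ _ => mul_nonneg htanh (hterm δ x (hSbox hx) y)
        _ ≤ ∑ x ∈ box d n, ∑ y ∈ box d n, ∑ δ : Fin d × Bool, Real.tanh β *
                (if (zdGraph d).Adj x y ∧ ¬ c δ 0 ∧ ¬ c δ x ∧ c δ y then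
                  isingTwoPoint (torusGraph d L) (W δ) β 0 .free (Torus.proj L 0) (Torus.proj L x) else 0) := by
            refine sum_le_sum_of_subset_of_nonneg hSbox fun x hx _ => ?_
            exact sum_nonneg fun y _ => sum_nonneg fun δ _ => mul_nonneg htanh (hterm δ x hx y)
    -- reorder the sums
    have hre : ∑ x ∈ box d n, ∑ y ∈ box d n, ∑ δ : Fin d × Bool, Real.tanh β *
        (if (zdGraph d).Adj x y ∧ ¬ c δ 0 ∧ ¬ c δ x ∧ c δ y then
          isingTwoPoint (torusGraph d L) (W δ) β 0 .free (Torus.proj L 0) (Torus.proj L x) else 0) =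
        Real.tanh β * ∑ δ : Fin d × Bool, ∑ x ∈ box d n, ∑ y ∈ box d n,
          (if (zdGraph d).Adj x y ∧ ¬ c δ 0 ∧ ¬ c δ x ∧ c δ y then
            isingTwoPoint (torusGraph d L) (W δ) β 0 .free (Torus.proj L 0) (Torus.proj L x) else 0) := by
      simp only [Finset.mul_sum]
      calc ∑ x ∈ box d n, ∑ y ∈ box d n, ∑ δ : Fin d × Bool, Real.tanh β *
            (if (zdGraph d).Adj x y ∧ ¬ c δ 0 ∧ ¬ c δ x ∧ c δ y then
              isingTwoPoint (torusGraph d L) (W δ) β 0 .free (Torus.proj L 0) (Torus.proj L x) else 0)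
          = ∑ x ∈ box d n, ∑ δ : Fin d × Bool, ∑ y ∈ box d n, Real.tanh β *
            (if (zdGraph d).Adj x y ∧ ¬ c δ 0 ∧ ¬ c δ x ∧ c δ y then
              isingTwoPoint (torusGraph d L) (W δ) β 0 .free (Torus.proj L 0) (Torus.proj L x) else 0) :=
            Finset.sum_congr rfl fun x _ => Finset.sum_comm
        _ = ∑ δ : Fin d × Bool, ∑ x ∈ box d n, ∑ y ∈ box d n, Real.tanh β *
            (if (zdGraph d).Adj x y ∧ ¬ c δ 0 ∧ ¬ c δ x ∧ c δ y then
              isingTwoPoint (torusGraph d L) (W δ) β 0 .free (Torus.proj L 0) (Torus.proj L x) else 0) :=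
            Finset.sum_comm
    rw [hre] at hB
    linarith

/-! ### Integration over the sourceless current on the torus -/

section Integrate

open scoped ENNReal symmDiff

variable {L : ℕ} [NeZero L]

/-- `ofReal` of an indicator sum is the sum of the `ℝ≥0∞` indicators. [folklore] -/
theorem ofReal_sum_ite_one {ι : Type*} (s : Finset ι) (c : ι → Prop) [∀ i, Decidable (c i)] :
    ENNReal.ofReal (∑ i ∈ s, if c i then (1 : ℝ) else 0) = ∑ i ∈ s, ind (c i) := by
  rw [ENNReal.ofReal_sum_of_nonneg (fun i _ => by split_ifs <;> norm_num)]
  refine Finset.sum_congr rfl fun i _ => ?_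
  by_cases h : c i
  · rw [if_pos h, ind_of_true h, ENNReal.ofReal_one]
  · rw [if_neg h, ind_of_false h, ENNReal.ofReal_zero]

/-- `ofReal (if P then v else 0) = 𝟙[P] · ofReal v`. [folklore] -/
theorem ofReal_ite_eq_ind_mul (P : Prop) [Decidable P] (v : ℝ) :
    ENNReal.ofReal (if P then v else 0) = ind P * ENNReal.ofReal v := by
  by_cases h : P
  · rw [if_pos h, ind_of_true h, one_mul]
  · rw [if_neg h, ind_of_false h, zero_mul, ENNReal.ofReal_zero]

/-- **Lemma 2.4 of Duminil-Copin–Panis 2025 (current form)**: for a fold datum, `o ∈ H₋` and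
`β ≥ 0`, `Z^∅[o ↔_ℳ ℍ] ≤ Z^{{o, θo}}` — by Lemma 2.3 (`IsFoldable.tsum_switch_reflected_eq`) the left
side equals `Z^{{o,θo}}[o ↔_ℳ ℍ]` ("`Z^∅_{Λ,β}[0 ∉ 𝒮_n(+e₁)] = … = Z^{{0,𝓡_n(0)}}_{Λ,β}`", eq. (2.12)).
[cite: DuminilCopinPanis2025LowerBounds, Lemma 2.4 (proof, eq. (2.12))] -/
theorem _root_.Literature.Probability.LatticeModels.IsFoldable.tsum_empty_connFix_le
    {V : Type*} [DecidableEq V] {G : SimpleGraph V} [G.LocallyFinite] {θ : V ≃ V} {Λ Hm : Finset V}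
    (h : IsFoldable G θ Λ Hm) {o : V} (ho : o ∈ Hm) {β : ℝ} (hβ : 0 ≤ β) :
    ∑' n, ind (csources G Λ n = ∅ ∧ CSupp G Λ (edgesIn G Λ) n) * cweight G Λ β n * ind (h.ConnFix (h.fold n) o) ≤
      currentZ G Λ β (edgesIn G Λ) ({o} ∆ {θ o}) := by
  have hE : ∀ e ∈ edgesIn G Λ, e ∈ edgesIn G Λ ↔ Sym2.map θ e ∈ edgesIn G Λ := fun e he =>
    ⟨fun he' => h.map_mem_edgesIn he', fun _ => he⟩
  rw [h.tsum_switch_reflected_eq ∅ hE ho hβ]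
  unfold currentZ
  refine ENNReal.tsum_le_tsum fun n => ?_
  rw [show (∅ : Finset V) ∆ ({o} ∆ {θ o}) = {o} ∆ {θ o} from bot_symmDiff _]
  exact mul_le_of_le_one_right bot_le (ind_le_one _)

/-- **Current sums of the whole torus are finite** and give the two-point function:
`⟨σ_aσ_b⟩_{𝕋_L} = Z({a} ∆ {b}) / Z(∅)`. [cite: DuminilCopinECM2018, §2.2.1 (high-temperature expansion)] -/
theorem currentZ_univ_ne_top {V : Type*} [Fintype V] [DecidableEq V] (G : SimpleGraph V) [G.LocallyFinite]
    {β : ℝ} (hβ : 0 ≤ β) (A : Finset V) :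
    currentZ G Finset.univ β (edgesIn G Finset.univ) A ≠ ∞ := by
  rw [currentZ_edgesIn_eq G Finset.univ hβ (Finset.Subset.refl _)]
  exact ENNReal.ofReal_ne_top

/-- **The two-point function of the whole (finite) graph as a ratio of current sums**:
`⟨σ_aσ_b⟩^∅ = Z({a} ∆ {b}) / Z(∅)` (random-current representation, Duminil-Copin 2016, §2.2.1 with
Remark 3.4). [cite: DuminilCopinECM2018, §2.2.1 (high-temperature expansion)] -/
theorem isingTwoPoint_univ_eq_currentZ_div {V : Type*} [Fintype V] [DecidableEq V] (G : SimpleGraph V)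
    [G.LocallyFinite] {β : ℝ} (hβ : 0 ≤ β) (a b : V) :
    isingTwoPoint G Finset.univ β 0 .free a b =
      (currentZ G Finset.univ β (edgesIn G Finset.univ) ({a} ∆ {b})).toReal /
        (currentZ G Finset.univ β (edgesIn G Finset.univ) ∅).toReal := by
  rw [isingTwoPoint_free_eq_hteSum_div G Finset.univ β (Finset.mem_univ a) (Finset.mem_univ b),
    currentZ_edgesIn_eq G Finset.univ hβ (Finset.Subset.refl _),
    currentZ_edgesIn_eq G Finset.univ hβ (Finset.Subset.refl _),
    ENNReal.toReal_ofReal (mul_nonneg (pow_nonneg (Real.cosh_pos β).le _) (hteSum_nonneg G _ (tanh_nonneg hβ) _)),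
    ENNReal.toReal_ofReal (mul_nonneg (pow_nonneg (Real.cosh_pos β).le _) (hteSum_nonneg G _ (tanh_nonneg hβ) _)),
    mul_div_mul_left _ _ (pow_pos (Real.cosh_pos β) _).ne']

/-- The zero current gives `1 ≤ Z(∅)`. [folklore] -/
theorem one_le_currentZ_univ_empty {V : Type*} [Fintype V] [DecidableEq V] (G : SimpleGraph V) [G.LocallyFinite]
    (β : ℝ) : 1 ≤ currentZ G Finset.univ β (edgesIn G Finset.univ) ∅ := by
  unfold currentZ
  refine le_trans (le_of_eq ?_) (ENNReal.le_tsum (0 : edgesIn G Finset.univ → ℕ))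
  rw [ind_of_true ⟨by simp [csources, cdeg], fun e he => absurd rfl he⟩]
  simp [cweight, edgeWeight]


/-- The folded current of the reflected current is the same folded current. [folklore] -/
theorem _root_.Literature.Probability.LatticeModels.IsFoldable.fold_creflect
    {V : Type*} [DecidableEq V] {G : SimpleGraph V} [G.LocallyFinite] {θ : V ≃ V} {Λ Hm : Finset V}
    (h : IsFoldable G θ Λ Hm) (n : edgesIn G Λ → ℕ) : h.fold (h.creflect n) = h.fold n := by
  funext e
  unfold IsFoldable.fold IsFoldable.creflect
  split_ifs
  · rw [h.edgeRefl_edgeRefl, add_comm]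
  · rfl

/-- Cross-multiplied weights of reflected currents. [folklore] -/
theorem _root_.Literature.Probability.LatticeModels.IsFoldable.csupp_creflect_edgesIn
    {V : Type*} [DecidableEq V] {G : SimpleGraph V} [G.LocallyFinite] {θ : V ≃ V} {Λ Hm : Finset V}
    (_h : IsFoldable G θ Λ Hm) (n : edgesIn G Λ → ℕ) : CSupp G Λ (edgesIn G Λ) n := fun e _ => e.2

/-- **`Z^{{o, θx}} ≤ Z^{{o, x}}` for `o, x ∈ H₋`** (Duminil-Copin–Panis 2025, proof of Lemma 2.5, the
step `Z^{{0,x}}[x ↔_ℳ ℍ] = Z^{{0,𝓡 x}}[x ↔_ℳ ℍ] = Z^{{0,𝓡 x}}`): every current with sources `{o, θx}`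
connects `x` to `ℍ` in its folded current (handshake for the reflected current), so by Lemma 2.3
`Z^{{o,θx}} = Z^{{o,x}}[x ↔_ℳ ℍ] ≤ Z^{{o,x}}`. [cite: DuminilCopinPanis2025LowerBounds, Lemma 2.5 (proof, eq. (2.22))] -/
theorem _root_.Literature.Probability.LatticeModels.IsFoldable.currentZ_pair_theta_le
    {V : Type*} [DecidableEq V] {G : SimpleGraph V} [G.LocallyFinite] {θ : V ≃ V} {Λ Hm : Finset V}
    (h : IsFoldable G θ Λ Hm) {o x : V} (ho : o ∈ Hm) (hx : x ∈ Hm) {β : ℝ} (hβ : 0 ≤ β) :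
    currentZ G Λ β (edgesIn G Λ) ({o} ∆ {θ x}) ≤ currentZ G Λ β (edgesIn G Λ) ({o} ∆ {x}) := by
  classical
  have hE : ∀ e ∈ edgesIn G Λ, e ∈ edgesIn G Λ ↔ Sym2.map θ e ∈ edgesIn G Λ := fun e he =>
    ⟨fun he' => h.map_mem_edgesIn he', fun _ => he⟩
  have hθo : θ o ∉ Hm := h.left_disjoint o ho
  have hxθo : x ≠ θ o := fun hxo => hθo (hxo ▸ hx)
  -- every current with sources `{o, θx}` connects `x` to the hyperplane in its fold
  have hconn : ∀ n : edgesIn G Λ → ℕ, csources G Λ n = {o} ∆ {θ x} → h.ConnFix (h.fold n) x := by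
    intro n hn
    rw [← h.fold_creflect n]
    refine h.connFix_fold_of_sources (h.creflect n) hx fun v hv => ?_
    rw [h.csources_creflect, hn, Finset.image_symmDiff _ _ θ.injective, image_singleton, image_singleton, h.invol x,
      mem_symmDiff, mem_singleton, mem_singleton]
    constructor
    · rintro (⟨rfl, -⟩ | ⟨rfl, -⟩)
      · exact absurd hv hθo
      · rfl
    · rintro rfl
      exact Or.inr ⟨rfl, hxθo⟩
  have hset : ({o} : Finset V) ∆ {θ x} = ({o} ∆ {x}) ∆ ({x} ∆ {θ x}) := by
    rw [symmDiff_assoc, symmDiff_symmDiff_cancel_left]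
  calc currentZ G Λ β (edgesIn G Λ) ({o} ∆ {θ x})
      = ∑' n, ind (csources G Λ n = ({o} ∆ {x}) ∆ ({x} ∆ {θ x}) ∧ CSupp G Λ (edgesIn G Λ) n) * cweight G Λ β n *
          ind (h.ConnFix (h.fold n) x) := by
        unfold currentZ
        refine tsum_congr fun n => ?_
        rw [← hset]
        by_cases hn : csources G Λ n = {o} ∆ {θ x} ∧ CSupp G Λ (edgesIn G Λ) n
        · rw [ind_of_true (hconn n hn.1), mul_one]
        · rw [ind_of_false hn, zero_mul, zero_mul]
    _ = ∑' n, ind (csources G Λ n = {o} ∆ {x} ∧ CSupp G Λ (edgesIn G Λ) n) * cweight G Λ β n *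
          ind (h.ConnFix (h.fold n) x) := (h.tsum_switch_reflected_eq ({o} ∆ {x}) hE hx hβ).symm
    _ ≤ currentZ G Λ β (edgesIn G Λ) ({o} ∆ {x}) := by
        unfold currentZ
        exact ENNReal.tsum_le_tsum fun n => mul_le_of_le_one_right bot_le (ind_le_one _)

/-- Nonnegativity of the summands of the triple sum. [folklore] -/
theorem ite_twoPoint_nonneg {n : ℕ} {β : ℝ} (hβ : 0 ≤ β) (c : Fin d × Bool → Site d → Prop)
    [∀ δ z, Decidable (c δ z)] (δ : Fin d × Bool) {x : Site d} (hx : x ∈ box d n) (y : Site d) :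
    0 ≤ (if (zdGraph d).Adj x y ∧ ¬ c δ 0 ∧ ¬ c δ x ∧ c δ y then
      isingTwoPoint (torusGraph d L) (((box d n).filter fun z => ¬ c δ z).image (Torus.proj L)) β 0 .free
        (Torus.proj L 0) (Torus.proj L x) else 0) := by
  split_ifs with h
  · refine isingTwoPoint_free_nonneg_of_mem _ hβ ?_ ?_
    · exact mem_image.2 ⟨0, mem_filter.2 ⟨zero_mem_box d n, h.2.1⟩, rfl⟩
    · exact mem_image.2 ⟨x, mem_filter.2 ⟨hx, h.2.2.1⟩, rfl⟩
  · exact le_rfl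

open Classical in
/-- **The torus inequality from Lemma 2.5.** On the even torus `(ℤ/Lℤ)^d` (`L ≥ 4n + 2`), at
`β ≥ 0`, write `Z(A)` for the current sums of the whole torus, `θ_δ` / `H_δ` for the `2d` direction
fold data (`dirTheta`, `dirHalf`), `c_δ(𝐧, z) = [z̄ ↔_{ℳ_δ(𝐧)} ℍ_δ]` and
`W_δ(𝐧) = {z̄ : z ∈ Λ_n, ¬c_δ(𝐧,z)}`. If the sharpness input `φ_β(S) ≥ 1` holds for the finite `S ∋ 0`
inside `Λ_n` (the finite-size criterion; at `β_c` it is `n ≤ L(β_c) = ∞`) and **Lemma 2.5** of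
Duminil-Copin–Panis 2025 holds in the per-pair form
`∑_{∂𝐧 = ∅} w(𝐧) 𝟙[0̄, x̄ ∈ W_δ(𝐧), c_δ(𝐧,y)] ⟨σ_{0̄}σ_{x̄}⟩_{W_δ(𝐧)} ≤ (Z(0̄x̄) - Z(0̄ θ_δx̄)) ⟨σ_ȳσ_{θ_δȳ}⟩_{𝕋_L}`
(with `Z(0̄ θ_δx̄) ≤ Z(0̄x̄)`), then
`1 ≤ ∑_δ ( ⟨σ_{0̄}σ_{θ_δ0̄}⟩_{𝕋_L} + tanh β ∑_{x,y ∈ Λ_n, y∼x} (⟨σ_{0̄}σ_{x̄}⟩ - ⟨σ_{0̄}σ_{θ_δ x̄}⟩) ⟨σ_ȳσ_{θ_δȳ}⟩ )`: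
integrate the pointwise inequality (`pointwise_master`) against `𝐏^∅_{𝕋_L}`, use Lemma 2.4
(`IsFoldable.tsum_empty_connFix_le`) for the first terms and Lemma 2.5 for the others, and divide by
`Z(∅)` (Duminil-Copin–Panis 2025, §2.2, (2.20)–(2.24) and "Theorem 1.2 follows from (2.24) and Lemma 2.5").
[cite: DuminilCopinPanis2025LowerBounds, §2.2, eqs. (2.20)–(2.24)] -/
theorem torusIneq_of_lemma25 (hL : Even L) {n : ℕ} (hn : 1 ≤ n) (hnL : 4 * n + 2 ≤ L) {β : ℝ} (hβ : 0 ≤ β)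
    (hφ : ∀ S : Finset (Site d), (0 : Site d) ∈ S → S ⊆ box d n → 1 ≤ dctIsingPhi d β S)
    (H25 : ∀ δ : Fin d × Bool, ∀ x ∈ box d n, ∀ y ∈ box d n, (zdGraph d).Adj x y →
      ∑' nc : edgesIn (torusGraph d L) univ → ℕ,
        ind (csources (torusGraph d L) univ nc = ∅ ∧ CSupp (torusGraph d L) univ (edgesIn (torusGraph d L) univ) nc) *
          cweight (torusGraph d L) univ β nc *
          (ind (¬ (isFoldable_dir hL (by omega) n δ).ConnFix ((isFoldable_dir hL (by omega) n δ).fold nc) (Torus.proj L 0) ∧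
                ¬ (isFoldable_dir hL (by omega) n δ).ConnFix ((isFoldable_dir hL (by omega) n δ).fold nc) (Torus.proj L x) ∧
                (isFoldable_dir hL (by omega) n δ).ConnFix ((isFoldable_dir hL (by omega) n δ).fold nc) (Torus.proj L y)) *
            ENNReal.ofReal (isingTwoPoint (torusGraph d L)
              (((box d n).filter fun z => ¬ (isFoldable_dir hL (by omega) n δ).ConnFix
                  ((isFoldable_dir hL (by omega) n δ).fold nc) (Torus.proj L z)).image (Torus.proj L))
              β 0 .free (Torus.proj L 0) (Torus.proj L x))) ≤
        (currentZ (torusGraph d L) univ β (edgesIn (torusGraph d L) univ) ({Torus.proj L 0} ∆ {Torus.proj L x}) -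
            currentZ (torusGraph d L) univ β (edgesIn (torusGraph d L) univ)
              ({Torus.proj L 0} ∆ {dirTheta L n δ (Torus.proj L x)})) *
          ENNReal.ofReal (isingTwoPoint (torusGraph d L) univ β 0 .free (Torus.proj L y) (dirTheta L n δ (Torus.proj L y))))
    (Hle : ∀ δ : Fin d × Bool, ∀ x ∈ box d n,
      currentZ (torusGraph d L) univ β (edgesIn (torusGraph d L) univ) ({Torus.proj L 0} ∆ {dirTheta L n δ (Torus.proj L x)}) ≤
        currentZ (torusGraph d L) univ β (edgesIn (torusGraph d L) univ) ({Torus.proj L 0} ∆ {Torus.proj L x})) :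
    (1 : ℝ) ≤ ∑ δ : Fin d × Bool,
      (isingTwoPoint (torusGraph d L) univ β 0 .free (Torus.proj L 0) (Torus.proj L (dirRefl δ n 0)) +
        Real.tanh β * ∑ x ∈ box d n, ∑ y ∈ box d n,
          if (zdGraph d).Adj x y then
            (isingTwoPoint (torusGraph d L) univ β 0 .free (Torus.proj L 0) (Torus.proj L x) -
                isingTwoPoint (torusGraph d L) univ β 0 .free (Torus.proj L 0) (Torus.proj L (dirRefl δ n x))) *
              isingTwoPoint (torusGraph d L) univ β 0 .free (Torus.proj L y) (Torus.proj L (dirRefl δ n y))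
          else 0) := by
  classical
  -- notation
  set GT := torusGraph d L with hGT
  set E := edgesIn GT univ with hE
  have h2L : 2 < L := by omega
  set hD : ∀ δ : Fin d × Bool, IsFoldable GT (dirTheta L n δ) univ (dirHalf L n δ) :=
    fun δ => isFoldable_dir hL h2L n δ with hhD
  -- the connection predicates of a current and the random volumes
  set cT : (E → ℕ) → Fin d × Bool → Site d → Prop :=
    fun nc δ z => (hD δ).ConnFix ((hD δ).fold nc) (Torus.proj L z) with hcT
  set Z : Finset (TorusSite d L) → ℝ≥0∞ := fun A => currentZ GT univ β E A with hZ
  set wt : (E → ℕ) → ℝ≥0∞ := fun nc => ind (csources GT univ nc = ∅ ∧ CSupp GT univ E nc) * cweight GT univ β nc with hwt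
  set p0 := Torus.proj L (0 : Site d) with hp0
  -- face points are connected
  have hface : ∀ nc : E → ℕ, ∀ z ∈ box d n, ∀ i : Fin d,
      (z i = n → cT nc (i, true) z) ∧ (z i = -(n : ℤ) → cT nc (i, false) z) := by
    intro nc z hz i
    constructor
    · intro hzi
      refine ⟨Torus.proj L z, mem_univ _, dirTheta_proj_eq_self hL hnL hz (i, true) (by simpa [sgn] using hzi), ?_⟩
      exact Relation.ReflTransGen.refl
    · intro hzi
      refine ⟨Torus.proj L z, mem_univ _, dirTheta_proj_eq_self hL hnL hz (i, false) (by simpa [sgn] using hzi), ?_⟩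
      exact Relation.ReflTransGen.refl
  -- the pointwise inequality for every current
  set A : (E → ℕ) → ℝ := fun nc => ∑ δ : Fin d × Bool, if cT nc δ 0 then (1 : ℝ) else 0 with hA
  set B : (E → ℕ) → ℝ := fun nc => ∑ δ : Fin d × Bool, ∑ x ∈ box d n, ∑ y ∈ box d n,
    (if (zdGraph d).Adj x y ∧ ¬ cT nc δ 0 ∧ ¬ cT nc δ x ∧ cT nc δ y then
      isingTwoPoint GT (((box d n).filter fun z => ¬ cT nc δ z).image (Torus.proj L)) β 0 .free p0 (Torus.proj L x)
    else 0) with hB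
  have hpt : ∀ nc, (1 : ℝ) ≤ A nc + Real.tanh β * B nc := fun nc =>
    pointwise_master (L := L) hn (by omega) hβ hφ (cT nc) (hface nc)
  have hA0 : ∀ nc, 0 ≤ A nc := fun nc => sum_nonneg fun δ _ => by split_ifs <;> norm_num
  have hB0 : ∀ nc, 0 ≤ B nc := fun nc =>
    sum_nonneg fun δ _ => sum_nonneg fun x hx => sum_nonneg fun y _ => ite_twoPoint_nonneg hβ (cT nc) δ hx y
  have htanh : 0 ≤ Real.tanh β := tanh_nonneg hβ
  -- Step 1: integrate the pointwise inequality against the sourceless current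
  have hZdef : Z ∅ = ∑' nc, wt nc := rfl
  have step1 : Z ∅ ≤ ∑' nc, (wt nc * ENNReal.ofReal (A nc) + ENNReal.ofReal (Real.tanh β) * (wt nc * ENNReal.ofReal (B nc))) := by
    rw [hZdef]
    refine ENNReal.tsum_le_tsum fun nc => ?_
    have h1 : (1 : ℝ≥0∞) ≤ ENNReal.ofReal (A nc + Real.tanh β * B nc) := ENNReal.one_le_ofReal.2 (hpt nc)
    calc wt nc = wt nc * 1 := (mul_one _).symm
      _ ≤ wt nc * ENNReal.ofReal (A nc + Real.tanh β * B nc) := mul_le_mul_right h1 _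
      _ = wt nc * ENNReal.ofReal (A nc) + ENNReal.ofReal (Real.tanh β) * (wt nc * ENNReal.ofReal (B nc)) := by
          rw [ENNReal.ofReal_add (hA0 nc) (mul_nonneg htanh (hB0 nc)), ENNReal.ofReal_mul htanh]
          ring
  rw [ENNReal.tsum_add, ENNReal.tsum_mul_left] at step1
  -- Step 2: the first term and Lemma 2.4
  have hp0H : ∀ δ, p0 ∈ dirHalf L n δ := fun δ => proj_zero_mem_dirHalf hL hn hnL δ
  have step2 : ∑' nc, wt nc * ENNReal.ofReal (A nc) ≤ ∑ δ : Fin d × Bool, Z ({p0} ∆ {dirTheta L n δ p0}) := by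
    have hre : ∀ nc, wt nc * ENNReal.ofReal (A nc) = ∑ δ : Fin d × Bool, wt nc * ind (cT nc δ 0) := by
      intro nc
      rw [hA]
      simp only
      rw [ofReal_sum_ite_one, Finset.mul_sum]
    simp_rw [hre]
    rw [Summable.tsum_finsetSum (fun _ _ => ENNReal.summable)]
    refine Finset.sum_le_sum fun δ _ => ?_
    exact (hD δ).tsum_empty_connFix_le (hp0H δ) hβ
  -- Step 3: the triple sum and Lemma 2.5
  set R : Fin d × Bool → Site d → Site d → ℝ≥0∞ := fun δ x y =>
    if (zdGraph d).Adj x y then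
      (Z ({p0} ∆ {Torus.proj L x}) - Z ({p0} ∆ {dirTheta L n δ (Torus.proj L x)})) *
        ENNReal.ofReal (isingTwoPoint GT univ β 0 .free (Torus.proj L y) (dirTheta L n δ (Torus.proj L y)))
    else 0 with hR
  have step3 : ∑' nc, wt nc * ENNReal.ofReal (B nc) ≤
      ∑ δ : Fin d × Bool, ∑ x ∈ box d n, ∑ y ∈ box d n, R δ x y := by
    have hre : ∀ nc, wt nc * ENNReal.ofReal (B nc) = ∑ δ : Fin d × Bool, ∑ x ∈ box d n, ∑ y ∈ box d n,
        wt nc * (ind ((zdGraph d).Adj x y ∧ ¬ cT nc δ 0 ∧ ¬ cT nc δ x ∧ cT nc δ y) *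
          ENNReal.ofReal (isingTwoPoint GT (((box d n).filter fun z => ¬ cT nc δ z).image (Torus.proj L)) β 0 .free
            p0 (Torus.proj L x))) := by
      intro nc
      rw [hB]
      simp only
      rw [ENNReal.ofReal_sum_of_nonneg (fun δ _ => sum_nonneg fun x hx => sum_nonneg fun y _ =>
        ite_twoPoint_nonneg hβ (cT nc) δ hx y), Finset.mul_sum]
      refine Finset.sum_congr rfl fun δ _ => ?_
      rw [ENNReal.ofReal_sum_of_nonneg (fun x hx => sum_nonneg fun y _ => ite_twoPoint_nonneg hβ (cT nc) δ hx y),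
        Finset.mul_sum]
      refine Finset.sum_congr rfl fun x hx => ?_
      rw [ENNReal.ofReal_sum_of_nonneg (fun y _ => ite_twoPoint_nonneg hβ (cT nc) δ hx y), Finset.mul_sum]
      refine Finset.sum_congr rfl fun y _ => ?_
      rw [ofReal_ite_eq_ind_mul]
    simp_rw [hre]
    rw [Summable.tsum_finsetSum (fun _ _ => ENNReal.summable)]
    refine Finset.sum_le_sum fun δ _ => ?_
    rw [Summable.tsum_finsetSum (fun _ _ => ENNReal.summable)]
    refine Finset.sum_le_sum fun x hx => ?_
    rw [Summable.tsum_finsetSum (fun _ _ => ENNReal.summable)]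
    refine Finset.sum_le_sum fun y hy => ?_
    by_cases hxy : (zdGraph d).Adj x y
    · rw [hR]
      simp only [if_pos hxy]
      have h25 := H25 δ x hx y hy hxy
      refine le_trans (le_of_eq (tsum_congr fun nc => ?_)) h25
      rw [ind_congr (show ((zdGraph d).Adj x y ∧ ¬ cT nc δ 0 ∧ ¬ cT nc δ x ∧ cT nc δ y) ↔
        (¬ cT nc δ 0 ∧ ¬ cT nc δ x ∧ cT nc δ y) from ⟨fun h => h.2, fun h => ⟨hxy, h⟩⟩)]
    · rw [hR]
      simp only [if_neg hxy]
      refine le_of_eq (ENNReal.tsum_eq_zero.2 fun nc => ?_)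
      rw [ind_of_false (fun h => hxy h.1), zero_mul, mul_zero]
  -- Step 4: the inequality in `ℝ≥0∞`
  have step4 : Z ∅ ≤ ∑ δ : Fin d × Bool, Z ({p0} ∆ {dirTheta L n δ p0}) +
      ENNReal.ofReal (Real.tanh β) * ∑ δ : Fin d × Bool, ∑ x ∈ box d n, ∑ y ∈ box d n, R δ x y :=
    step1.trans (add_le_add step2 (mul_le_mul_right step3 _))
  -- Step 5: to real numbers
  have hfin : ∀ A', Z A' ≠ ∞ := fun A' => currentZ_univ_ne_top GT hβ A'
  have hZ1 : 1 ≤ Z ∅ := one_le_currentZ_univ_empty GT β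
  set z0 : ℝ := (Z ∅).toReal with hz0def
  have hz0 : 0 < z0 := ENNReal.toReal_pos (ne_of_gt (lt_of_lt_of_le zero_lt_one hZ1)) (hfin ∅)
  have hdict : ∀ a b, isingTwoPoint GT univ β 0 .free a b = (Z ({a} ∆ {b})).toReal / z0 := fun a b =>
    isingTwoPoint_univ_eq_currentZ_div GT hβ a b
  have hdict' : ∀ a b, (Z ({a} ∆ {b})).toReal = z0 * isingTwoPoint GT univ β 0 .free a b := fun a b => by
    rw [hdict, mul_div_cancel₀ _ hz0.ne']
  have hRfin : ∀ δ x y, R δ x y ≠ ∞ := by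
    intro δ x y
    rw [hR]
    simp only
    split_ifs
    · exact ENNReal.mul_ne_top (ENNReal.sub_ne_top (hfin _)) ENNReal.ofReal_ne_top
    · exact ENNReal.zero_ne_top
  have hRreal : ∀ δ, ∀ x ∈ box d n, ∀ y, (R δ x y).toReal =
      if (zdGraph d).Adj x y then
        ((Z ({p0} ∆ {Torus.proj L x})).toReal - (Z ({p0} ∆ {dirTheta L n δ (Torus.proj L x)})).toReal) *
          isingTwoPoint GT univ β 0 .free (Torus.proj L y) (dirTheta L n δ (Torus.proj L y))
      else 0 := by
    intro δ x hx y
    rw [hR]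
    simp only
    split_ifs with hxy
    · rw [ENNReal.toReal_mul, ENNReal.toReal_sub_of_le (Hle δ x hx) (hfin _),
        ENNReal.toReal_ofReal (isingTwoPoint_free_nonneg_of_mem _ hβ (mem_univ _) (mem_univ _))]
    · rfl
  have hsumfin : ∀ δ : Fin d × Bool, ∑ x ∈ box d n, ∑ y ∈ box d n, R δ x y ≠ ∞ := fun δ =>
    ENNReal.sum_ne_top.2 fun x _ => ENNReal.sum_ne_top.2 fun y _ => hRfin δ x y
  have hRHSfin : ∑ δ : Fin d × Bool, Z ({p0} ∆ {dirTheta L n δ p0}) +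
      ENNReal.ofReal (Real.tanh β) * ∑ δ : Fin d × Bool, ∑ x ∈ box d n, ∑ y ∈ box d n, R δ x y ≠ ∞ :=
    ENNReal.add_ne_top.2 ⟨ENNReal.sum_ne_top.2 fun δ _ => hfin _,
      ENNReal.mul_ne_top ENNReal.ofReal_ne_top (ENNReal.sum_ne_top.2 fun δ _ => hsumfin δ)⟩
  have step5 : z0 ≤ ∑ δ : Fin d × Bool, (Z ({p0} ∆ {dirTheta L n δ p0})).toReal +
      Real.tanh β * ∑ δ : Fin d × Bool, ∑ x ∈ box d n, ∑ y ∈ box d n, (R δ x y).toReal := by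
    have h := ENNReal.toReal_mono hRHSfin step4
    rw [ENNReal.toReal_add (ENNReal.sum_ne_top.2 fun δ _ => hfin _)
        (ENNReal.mul_ne_top ENNReal.ofReal_ne_top (ENNReal.sum_ne_top.2 fun δ _ => hsumfin δ)),
      ENNReal.toReal_sum (fun δ _ => hfin _), ENNReal.toReal_mul, ENNReal.toReal_ofReal htanh,
      ENNReal.toReal_sum (fun δ _ => hsumfin δ)] at h
    refine h.trans (le_of_eq ?_)
    congr 1
    congr 1
    refine Finset.sum_congr rfl fun δ _ => ?_
    rw [ENNReal.toReal_sum (fun x _ => ENNReal.sum_ne_top.2 fun y _ => hRfin δ x y)]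
    refine Finset.sum_congr rfl fun x _ => ?_
    exact ENNReal.toReal_sum (fun y _ => hRfin δ x y)
  -- Step 6: divide by `Z(∅)` and identify the two-point functions
  have hθ0 : ∀ δ : Fin d × Bool, dirTheta L n δ p0 = Torus.proj L (dirRefl δ n 0) := fun δ => dirTheta_proj n δ 0
  have h1 : ∀ δ : Fin d × Bool, (Z ({p0} ∆ {dirTheta L n δ p0})).toReal =
      z0 * isingTwoPoint GT univ β 0 .free p0 (Torus.proj L (dirRefl δ n 0)) := fun δ => by
    rw [hθ0 δ, hdict']
  have h2 : ∀ δ : Fin d × Bool, ∑ x ∈ box d n, ∑ y ∈ box d n, (R δ x y).toReal =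
      z0 * ∑ x ∈ box d n, ∑ y ∈ box d n,
        (if (zdGraph d).Adj x y then
          (isingTwoPoint GT univ β 0 .free p0 (Torus.proj L x) -
              isingTwoPoint GT univ β 0 .free p0 (Torus.proj L (dirRefl δ n x))) *
            isingTwoPoint GT univ β 0 .free (Torus.proj L y) (Torus.proj L (dirRefl δ n y))
        else 0) := by
    intro δ
    rw [Finset.mul_sum]
    refine Finset.sum_congr rfl fun x hx => ?_
    rw [Finset.mul_sum]
    refine Finset.sum_congr rfl fun y _ => ?_
    rw [hRreal δ x hx y]
    split_ifs with hxy
    · rw [hdict' p0 (Torus.proj L x), dirTheta_proj n δ x, hdict', dirTheta_proj n δ y]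
      ring
    · rw [mul_zero]
  simp only [h1, h2] at step5
  rw [← Finset.mul_sum, ← Finset.mul_sum, ← mul_assoc, mul_comm (Real.tanh β) z0, mul_assoc, ← mul_add] at step5
  have hfinal : (1 : ℝ) ≤ ∑ δ : Fin d × Bool, isingTwoPoint GT univ β 0 .free p0 (Torus.proj L (dirRefl δ n 0)) +
      Real.tanh β * ∑ δ : Fin d × Bool, ∑ x ∈ box d n, ∑ y ∈ box d n,
        (if (zdGraph d).Adj x y then
          (isingTwoPoint GT univ β 0 .free p0 (Torus.proj L x) -
              isingTwoPoint GT univ β 0 .free p0 (Torus.proj L (dirRefl δ n x))) *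
            isingTwoPoint GT univ β 0 .free (Torus.proj L y) (Torus.proj L (dirRefl δ n y))
        else 0) := by
    nth_rewrite 1 [← mul_one z0] at step5
    exact le_of_mul_le_mul_left step5 hz0
  rw [Finset.mul_sum, ← Finset.sum_add_distrib] at hfinal
  exact hfinal

end Integrate

end DCPLower

end Literature.Probability.LatticeModels
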